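import Mathlib
import Summits.AtomisticToContinuum.HydrodynamicLimit.Theorems.InformationPercolationEngineKickFairRelEquilibriumMesoDefs
import HarnessLib

/-!
# `KickFairRelEquilibriumMeso`, line `Sketch` — stub RU (`stub_restartDeviationCut`) at RUNG 0, part 1:
# an unconditional window large-deviation bound under the invariant law gives RU at constant profiles

Helper file (`--supports stmt-AtomisticToContinuum-15177`) of the line lead (c5) for the registered stub
`stub_restartDeviationCut` (RU) of the skeleton `Cruxes/KickFairRelEquilibriumMeso/Lines/Sketch.lean` (rev 10/11).

RU asks, for continuous positive profiles, on level sets `B` of the time-zero key that are typical for the LOCAL Gibbs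
law (`LG(B) ≥ e^{-η(N+1)}`), the conditional speed-`N` deviation bound `G(B ∩ {|Z| > t_N/L}) ≤ e^{-c(N+1)} G(B)` for
the cut windowed `κ`-centred kick sum `Z = slotSum …` under the INVARIANT law `G = localGibbsLaw σ 1 0 1 N Φ`.
At RUNG 0 (constant profiles `a₀ ≡ 1, u₀ ≡ 0, θ₀ ≡ 1`, so that `LG = G`) the typicality hypothesis reads
`G(B) ≥ e^{-η(N+1)}` and RU is implied by the UNCONDITIONAL window large-deviation bound
`G({|Z| > t_N/L}) ≤ e^{-c(N+1)}` (`restartDeviationCut_rung0_of_windowLD`: take `c/2, η := c/2`;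
`G(B ∩ E) ≤ G(E) ≤ e^{-c(N+1)} = e^{-(c/2)(N+1)} e^{-(c/2)(N+1)} ≤ e^{-(c/2)(N+1)} G(B)`). Together with the converse
(registered sub-goal `windowLD_of_restartDeviationCut_rung0`, by the landed key count KC and energy tail E2) this
identifies the EQUILIBRIUM content of RU exactly: a speed-`N` concentration bound, unconditional, for the cut centred
kick sum of one kinetic window under the invariant hard-sphere law — an open statement of equilibrium hard-sphere
dynamics (no decorrelation estimate for the deterministic `N`-sphere flow at kinetic times is in print); the
NON-equilibrium content of RU is the passage from `G`-typical to `LG`-typical (hence `G`-exponentially-rare) level sets.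

References: C. Cercignani, R. Illner, M. Pulvirenti, *The Mathematical Theory of Dilute Gases* (1994), App. 4.A
(the invariant law); the line card `Cruxes/KickFairRelEquilibriumMeso/Ideas/two-time-pinch.md`.
-/

noncomputable section

open MeasureTheory Set Filter Topology
open scoped ENNReal Classical

namespace Summit.AtomisticToContinuum.HydrodynamicLimit.Theorems.KickFairRelEquilibriumMesoLine

open Literature.Analysis.FluidPDE Literature.MathematicalPhysics.KineticTheory

/-- **RU at rung 0 from an unconditional window large-deviation bound (registered sub-goal
`restartDeviationCut_rung0_of_windowLD`).** If under the invariant law `G = localGibbsLaw σ 1 0 1 N (Φ N)` the cut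
windowed centred kick sum satisfies `G({|Z| > t_N/L}) ≤ e^{-c(N+1)}` eventually, uniformly over cut weights and
kinetic windows, then the restart deviation stub RU holds at constant profiles `(1, 0, 1)` with rate `c/2` and
typicality threshold `η = c/2`: `G(B ∩ E) ≤ G(E) ≤ e^{-c(N+1)} ≤ e^{-(c/2)(N+1)} G(B)` whenever `G(B) ≥ e^{-(c/2)(N+1)}`.
[folklore] -/
theorem restartDeviationCut_rung0_of_windowLD :
    (∃ σ₀ : ℝ, 0 < σ₀ ∧ ∀ σ : ℝ, 0 < σ → σ < σ₀ → ∀ Φ : (N : ℕ) → Flow σ N, ∀ τ : ℝ, 0 < τ →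
    ∀ g : V3 × V3 × V3 → ℝ, Continuous g → (∃ C : ℝ, ∀ p, |g p| ≤ C) →
    ∀ L : ℝ, 0 < L → ∀ A : ℝ, 0 < A →
    ∃ c : ℝ, 0 < c ∧ ∃ N₀ : ℕ, ∀ N : ℕ, N₀ ≤ N →
    ∀ h : Fin (N + 1) → ℕ → Past N → ℝ, (∀ i n, Measurable (h i n)) → (∀ i n p, |h i n p| ≤ 1) →
    (∀ i n p, p.2.2.2 - p.2.1 < tN N / A → h i n p = 0) →
    ∀ t₁ t₂ : ℝ, 0 ≤ t₁ → t₁ ≤ t₂ → t₂ ≤ τ → t₂ ≤ t₁ + tN N →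
    localGibbsLaw σ (fun _ => 1) (fun _ => 0) (fun _ => 1) N (Φ N)
        {z | tN N / L < |slotSum (Φ N) τ (rs N) t₁ t₂ g h z|} ≤
      ENNReal.ofReal (Real.exp (-(c * ((N : ℝ) + 1))))) →
    ∃ σ₀ : ℝ, 0 < σ₀ ∧ ∀ σ : ℝ, 0 < σ → σ < σ₀ → ∀ Φ : (N : ℕ) → Flow σ N, ∀ τ : ℝ, 0 < τ →
    ∀ g : V3 × V3 × V3 → ℝ, Continuous g → (∃ C : ℝ, ∀ p, |g p| ≤ C) →
    ∀ L : ℝ, 0 < L → ∀ A : ℝ, 0 < A →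
    ∃ c : ℝ, 0 < c ∧ ∃ η : ℝ, 0 < η ∧ ∃ N₀ : ℕ, ∀ N : ℕ, N₀ ≤ N →
    ∀ h : Fin (N + 1) → ℕ → Past N → ℝ, (∀ i n, Measurable (h i n)) → (∀ i n p, |h i n p| ≤ 1) →
    (∀ i n p, p.2.2.2 - p.2.1 < tN N / A → h i n p = 0) →
    ∀ t₁ t₂ : ℝ, 0 ≤ t₁ → t₁ ≤ t₂ → t₂ ≤ τ → t₂ ≤ t₁ + tN N →
    ∀ z₀ : Phase N,
    ENNReal.ofReal (Real.exp (-(η * ((N : ℝ) + 1)))) ≤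
        localGibbsLaw σ (fun _ => 1) (fun _ => 0) (fun _ => 1) N (Φ N)
          {z | cellKey (rs N) (rs N) z = cellKey (rs N) (rs N) z₀} →
      localGibbsLaw σ (fun _ => 1) (fun _ => 0) (fun _ => 1) N (Φ N)
          ({z | cellKey (rs N) (rs N) z = cellKey (rs N) (rs N) z₀} ∩
            {z | tN N / L < |slotSum (Φ N) τ (rs N) t₁ t₂ g h z|}) ≤
        ENNReal.ofReal (Real.exp (-(c * ((N : ℝ) + 1)))) *
          localGibbsLaw σ (fun _ => 1) (fun _ => 0) (fun _ => 1) N (Φ N)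
            {z | cellKey (rs N) (rs N) z = cellKey (rs N) (rs N) z₀} := by
  rintro ⟨σ₀, hσ₀, hW⟩
  refine ⟨σ₀, hσ₀, fun σ hσ hσlt Φ τ hτ g hg hgb L hL A hA => ?_⟩
  obtain ⟨c, hc, N₀, hN⟩ := hW σ hσ hσlt Φ τ hτ g hg hgb L hL A hA
  refine ⟨c / 2, by positivity, c / 2, by positivity, N₀, fun N hN₀ h hhm hhb hcut t₁ t₂ h0 h12 h2τ hwin z₀ hB => ?_⟩
  have hE := hN N hN₀ h hhm hhb hcut t₁ t₂ h0 h12 h2τ hwin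
  set G := localGibbsLaw σ (fun _ => 1) (fun _ => 0) (fun _ => 1) N (Φ N) with hG
  set B : Set (Phase N) := {z | cellKey (rs N) (rs N) z = cellKey (rs N) (rs N) z₀} with hBdef
  set E : Set (Phase N) := {z | tN N / L < |slotSum (Φ N) τ (rs N) t₁ t₂ g h z|} with hEdef
  have hsplit : Real.exp (-(c * ((N : ℝ) + 1))) =
      Real.exp (-(c / 2 * ((N : ℝ) + 1))) * Real.exp (-(c / 2 * ((N : ℝ) + 1))) := by
    rw [← Real.exp_add]
    congr 1
    ring
  calc G (B ∩ E) ≤ G E := measure_mono inter_subset_right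
    _ ≤ ENNReal.ofReal (Real.exp (-(c * ((N : ℝ) + 1)))) := hE
    _ = ENNReal.ofReal (Real.exp (-(c / 2 * ((N : ℝ) + 1)))) *
          ENNReal.ofReal (Real.exp (-(c / 2 * ((N : ℝ) + 1)))) := by
        rw [hsplit, ENNReal.ofReal_mul (Real.exp_pos _).le]
    _ ≤ ENNReal.ofReal (Real.exp (-(c / 2 * ((N : ℝ) + 1)))) * G B := by
        gcongr
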